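import Literature.MathematicalPhysics.QuantumFieldTheory.Balaban1983to89.Step
import Literature.MathematicalPhysics.QuantumFieldTheory.Balaban1983to89.B14LocalCoupling

/-!
# `Balaban1983to89.B14Eq225Concrete` — CMP 119 (2.23)/(2.25) pp. 258–259 with the smeared Wilson actions WITH BODY:
# `A(1/g_k²(·), U)` (the localized coupling (2.24)) and `A(φ_j, U)` as plaquette sums, the regular part `𝐄_k(U_k)` (2.25)
# as a definition, the action (2.23) on these concrete data, and the coupling-constant renormalization identity behind
# them (telescoping (2.24) inside `A(·, U)`) PROVED

statement-level skeleton of published theorems with citation tags; proofs where landed; nothing here is a claim about the Yang–Mills mass gap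

CITATION HEADER (lean-in-tree rule).  Source: T. Bałaban, *Convergent renormalization expansions for lattice gauge
theories*, Commun. Math. Phys. **119**, 243–285 (1988), doi:10.1007/bf01217741 [Balaban1988Convergent] (cell paper
B14 = «[III]»; held `paper:balaban1988-cmp119-convergent-renormalization`, journal page = PDF page + 242; pp. 258–259,
279 read on the text layer `p0016`, `p0017`, `p0037` and the x2 render `…-p016-x2.png`).  Mega-formalization
`lit-balaban`, unit `lit-balaban-r11` (CMP 119, B14 fold owner), SKELETON rows **B14.Eq2.25** ((2.25)), **B14.Eq2.23**
((2.23)); neighbours B14.Eq2.24 (`B14.LocalCoupling.invSq`, proved), B14.Eq2.26–2.27 (the terms `E^{(j)}(X, U_k, z)` and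
their summation range), B14.Eq2.30 / 2.40–2.41 (`𝐑_k`, `𝐁_k`), B14.Def§2.Ek (`E_k`).

THE PRINTED TEXT (verbatim).  (2.23) p. 258: *"A_k(1/g_k², U_k) = −A(1/g_k²(·), U_k) + 𝐄_k(U_k) + 𝐑_k(U_k) + 𝐁_k(U_k, A)
− E_k."*  p. 259: *"We start the detailed description of the terms in the effective action (2.23) with the definition of
the function g_k²(x). It is defined by the sequence of the renormalization group equations generalizing Eqs. (I.0.20)
and (1.27): 1/g²_{j−1}(x) = 1/g_j²(x) + β_j(g_{j−1})φ_j(x). (2.24) … The term 𝐄_k has the representation (I.1.7), but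
localized properly: 𝐄_k(U_k) = Σ_{j=1}^{k} [E^{(j)}(Λ_j, g_{j−1}, U_k) − E^{(j)}(Λ_j, g_{j−1}, 1) − β_j(g_{j−1})A(φ_j, U_k)].
(2.25)"*; and p. 279: *"The coupling constant renormalization is performed by subtracting β_{k+1}(g_k)A(φ_{k+1}, U_{k+1})
from E^{(k+1)} − E^{(k+1)}(1), and by replacing the function g_k^{−2}(·) in the action A(g_k^{−2}(·), U_{k+1}) by
g_{k+1}^{−2}(·) defined by the equation (2.24) with j = k+1."*

THE CARRIERS (pre-existing, BY NAME).  `Setup.{GaugeField, Plaq, GaugeField.plaqHol, reTr, wilsonAction, wilsonAction4,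
Flow}`; the localized coupling `B14.LocalCoupling.invSq F φ j x = 1/g_j²(x)` ((2.24), row B14.Eq2.24 `proved`); the
pre-cell action record `Step.LFActionData` / `LFActionData.action23` ((2.23) with (2.25), (2.30), (2.40)–(2.41)
substituted), in which `A(1/g_k²(·), U)` and `A(φ_j, U)` were ABSTRACT fields (`wilsonLocal`, `wilsonPhi`).  Here they
receive bodies; the index predicates `admE/admR/admB` (the summation ranges of (2.26)–(2.27), (2.30), (2.41) — rows
B14.Eq2.26–2.27 / 2.30 / 2.40–2.41), the terms `T.E/R/B` (tower data) and the `S`-data stay what they are there.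

WHAT IS TYPED / PROVED (0 `sorry`; definitions with bodies + theorems; no `Prop`-def).
§1  **`smearedWilson w U = Σ_p w(p)·(1 − Re tr U(∂p))`** — the Wilson action with a plaquette weight (`A(φ, U)` of (2.25),
    `A(1/g_k²(·), U)` of (2.23), the weight = print's point function composed with print's plaquette ↦ point convention,
    a parameter); `smearedWilson_const` (= `wilsonAction c`), `smearedWilson_one` (= `wilsonAction4`), linearity
    `smearedWilson_add/sub/smul/zero`.
§2  **(2.24) inside `A(·, U)`, PROVED**: `smearedWilson_invSq_succ` (one step: `A(1/g_j²(·),U) = A(1/g_{j+1}²(·),U) +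
    β_{j+1}(g_j)A(φ_{j+1},U)`) and **`smearedWilson_invSq_telescope`** (`A(1/g₀², U) = A(1/g_k²(·), U) + Σ_{j=1}^{k}
    β_j(g_{j−1}) A(φ_j, U)` — the bookkeeping that makes *"coupling constant renormalization counterterms are included"*
    (p. 259) consistent with the bare action of the Wilson start).
§3  **(2.25) WITH BODY**: `E225 T admE φ k U` = `Σ_{j=1}^{k} [E^{(j)}(Λ_j, g_{j−1}, U) − E^{(j)}(Λ_j, g_{j−1}, 1) −
    β_j(g_{j−1})A(φ_j, U)]` with `E^{(j)}(Λ_j, g, U) = Σ_{z, X} E^{(j)}(X, U, z)` over the (2.26)–(2.27) range `admE`; the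
    concrete action data **`concrete T admE admR admB φ k a Ek : LFActionData P G T`** (`wilsonLocal := A(1/g_k²(·), ·)`,
    `wilsonPhi j := A(φ_j, ·)`), and **`action23_concrete`**: (2.23) on it reads `−A(1/g_k²(·),U) + 𝐄_k(U) + 𝐑_k(U) +
    𝐁_k(U, A) − E_k` with `𝐄_k = E225`, `𝐑_k = R230`, `𝐁_k = B240` (the (2.30)/(2.40) sums as definitions).

NOT ASSERTED: any property of the terms (rows B14.Eq2.26–2.42, Theorem 1), the choice of `φ_j` (*"φ_j ∈ C₀^∞(Λ_j), φ_j = 1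
on Λ_j^{∼−1}"* enters `invSq`'s users as hypotheses, row B14.Eq2.24), the plaquette ↦ point convention.

## References
* [Balaban1988Convergent] T. Bałaban, Commun. Math. Phys. 119 (1988) 243–285, (2.23)–(2.25) pp. 258–259, p. 279.
-/

noncomputable section

namespace Literature.MathematicalPhysics.QuantumFieldTheory.Balaban1983to89.B14.Eq225Concrete

open Literature.MathematicalPhysics.QuantumFieldTheory.Balaban1983to89
open Step B14.LocalCoupling Finset

variable {P : Params} {G : Type*} [GaugeGroup G]

/-! ## §1. The Wilson action with a plaquette weight -/

/-- **`A(w, U) = Σ_p w(p)·[1 − Re tr U(∂p)]`** — the Wilson action smeared with a plaquette weight `w` ((2.25): `A(φ_j, U)`;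
(2.23): `A(1/g_k²(·), U)` with the localized coupling (2.24)). [cite: Balaban1988Convergent, (2.23)/(2.25) pp.258–259] -/
def smearedWilson (w : Plaq P 0 → ℝ) (U : GaugeField P 0 G) : ℝ :=
  ∑ p : Plaq P 0, w p * (1 - reTr (GaugeField.plaqHol U p))

/-- A constant weight gives `Setup.wilsonAction`. [cite: Balaban1988Convergent, (2.23) p.258] -/
theorem smearedWilson_const (c : ℝ) (U : GaugeField P 0 G) : smearedWilson (fun _ => c) U = wilsonAction c U := rfl

/-- The unit weight gives the Wilson action `A(U)`. [cite: Balaban1988Convergent, (2.23) p.258] -/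
theorem smearedWilson_one (U : GaugeField P 0 G) : smearedWilson (fun _ => (1 : ℝ)) U = wilsonAction4 U := rfl

/-- Additivity in the weight. [cite: Balaban1988Convergent, (2.24)/(2.25) p.259] -/
theorem smearedWilson_add (w w' : Plaq P 0 → ℝ) (U : GaugeField P 0 G) :
    smearedWilson (fun p => w p + w' p) U = smearedWilson w U + smearedWilson w' U := by
  simp only [smearedWilson, add_mul, sum_add_distrib]

/-- Subtraction in the weight. [cite: Balaban1988Convergent, (2.24)/(2.25) p.259] -/
theorem smearedWilson_sub (w w' : Plaq P 0 → ℝ) (U : GaugeField P 0 G) :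
    smearedWilson (fun p => w p - w' p) U = smearedWilson w U - smearedWilson w' U := by
  simp only [smearedWilson, sub_mul, sum_sub_distrib]

/-- Homogeneity in the weight (`A(βφ, U) = βA(φ, U)`). [cite: Balaban1988Convergent, (2.25) p.259] -/
theorem smearedWilson_smul (c : ℝ) (w : Plaq P 0 → ℝ) (U : GaugeField P 0 G) :
    smearedWilson (fun p => c * w p) U = c * smearedWilson w U := by
  simp only [smearedWilson, mul_assoc, mul_sum]

/-- Zero weight. [cite: Balaban1988Convergent, (2.25) p.259] -/
@[simp] theorem smearedWilson_zero (U : GaugeField P 0 G) : smearedWilson (fun _ => (0 : ℝ)) U = 0 := by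
  simp [smearedWilson]

/-! ## §2. The renormalization group equations (2.24) inside `A(·, U)` -/

/-- ONE STEP of (2.24) inside the action: `A(1/g_j²(·), U) = A(1/g_{j+1}²(·), U) + β_{j+1}(g_j)·A(φ_{j+1}, U)` (from
`B14.LocalCoupling.invSq_rec`, pointwise on plaquettes). [cite: Balaban1988Convergent, (2.24) p.259] -/
theorem smearedWilson_invSq_succ (F : Flow) (φ : ℕ → Plaq P 0 → ℝ) (j : ℕ) (U : GaugeField P 0 G) :
    smearedWilson (invSq F φ j) U =
      smearedWilson (invSq F φ (j + 1)) U + F.β (j + 1) (F.g j) * smearedWilson (φ (j + 1)) U := by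
  rw [← smearedWilson_smul, ← smearedWilson_add]
  congr 1
  funext p
  exact invSq_rec F φ j p

/-- **TELESCOPING (2.24) inside the action**: `A(1/g₀², U) = A(1/g_k²(·), U) + Σ_{j=1}^{k} β_j(g_{j−1})·A(φ_j, U)` — the
bare Wilson term of the start `ρ₀ = exp[−(1/g₀²)A − E]` equals the localized term of (2.23) plus the coupling constant
renormalization counterterms of (2.25) (*"fully renormalized, i.e. vacuum energy and coupling constant renormalization
counterterms are included into it"*, p. 259; p. 279). [cite: Balaban1988Convergent, (2.23)–(2.25) pp.258–259, p.279] -/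
theorem smearedWilson_invSq_telescope (F : Flow) (φ : ℕ → Plaq P 0 → ℝ) (U : GaugeField P 0 G) :
    ∀ k : ℕ, smearedWilson (invSq F φ 0) U =
      smearedWilson (invSq F φ k) U + ∑ j ∈ Icc 1 k, F.β j (F.g (j - 1)) * smearedWilson (φ j) U
  | 0 => by simp
  | k + 1 => by
    rw [smearedWilson_invSq_telescope F φ U k, smearedWilson_invSq_succ F φ k U,
      Finset.sum_Icc_succ_top (show 1 ≤ k + 1 by omega), Nat.add_sub_cancel]
    ring

/-- The bare coupling weight is the constant `1/g₀²`: `A(1/g₀²(·), U) = (1/g₀²)·A(U)`. [cite: Balaban1988Convergent, (2.24) p.259] -/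
theorem smearedWilson_invSq_zero (F : Flow) (φ : ℕ → Plaq P 0 → ℝ) (U : GaugeField P 0 G) :
    smearedWilson (invSq F φ 0) U = 1 / (F.g 0) ^ 2 * wilsonAction4 U := by
  rw [← smearedWilson_one, ← smearedWilson_smul]
  simp [invSq]

/-! ## §3. (2.25) and (2.23) on the concrete data -/

variable {Φ 𝒢 𝔄 : Type*}

/-- `E^{(j)}(Λ_j, g, U) − E^{(j)}(Λ_j, g, 1)` — the vacuum-subtracted scale-`j` regular term summed over its (2.26)–(2.27)
range (the index predicate `admE j X z` = "z ∈ Λ_j⁰, X ∋ z, X ⊂ Λ_j", rows B14.Eq2.26–2.27), evaluated at the background of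
`U`. [cite: Balaban1988Convergent, (2.25)–(2.27) p.259] -/
def EjSub (T : LFTower P G Φ 𝒢 𝔄) (admE : (j : ℕ) → (T.sys j).Dom → T.Pt j → Bool) (j : ℕ) (U : GaugeField P 0 G) : ℝ :=
  ∑ X : (T.sys j).Dom, ∑ z : T.Pt j,
    if admE j X z then ((T.E j X z (T.flow.g (j - 1)) (T.ofBackground U)).re
      - (T.E j X z (T.flow.g (j - 1)) (T.ofBackground 1)).re) else 0

/-- **(2.25) WITH BODY**: `𝐄_k(U) = Σ_{j=1}^{k} [E^{(j)}(Λ_j, g_{j−1}, U) − E^{(j)}(Λ_j, g_{j−1}, 1) − β_j(g_{j−1})A(φ_j, U)]`.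
[cite: Balaban1988Convergent, (2.25) p.259] -/
def E225 (T : LFTower P G Φ 𝒢 𝔄) (admE : (j : ℕ) → (T.sys j).Dom → T.Pt j → Bool) (φ : ℕ → Plaq P 0 → ℝ) (k : ℕ)
    (U : GaugeField P 0 G) : ℝ :=
  ∑ j ∈ Icc 1 k, (EjSub T admE j U - T.flow.β j (T.flow.g (j - 1)) * smearedWilson (φ j) U)

/-- (2.30) substituted: `𝐑_k(U) = Σ_{j=1}^{k} Σ_X [𝐑^{(j)}(X, U) − 𝐑^{(j)}(X, 1)]` over the (2.30) range `admR` (row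
B14.Eq2.30). [cite: Balaban1988Convergent, (2.30) p.260] -/
def R230 (T : LFTower P G Φ 𝒢 𝔄) (admR : (j : ℕ) → (T.sys j).Dom → Bool) (k : ℕ) (U : GaugeField P 0 G) : ℝ :=
  ∑ j ∈ Icc 1 k, ∑ X : (T.sys j).Dom,
    (if admR j X then ((T.R j X (T.ofBackground U)).re - (T.R j X (T.ofBackground 1)).re) else 0)

/-- (2.40) substituted: `𝐁_k(U, A) = Σ_{j=1}^{k} Σ_X 𝐁^{(j)}(X, U, A, {S_i ∩ X})` over the (2.41) range `admB` (rows
B14.Eq2.40–2.41). [cite: Balaban1988Convergent, (2.40) p.261] -/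
def B240 (T : LFTower P G Φ 𝒢 𝔄) (admB : (j : ℕ) → (T.sys j).Dom → Bool) (a : 𝔄) (k : ℕ) (U : GaugeField P 0 G) : ℝ :=
  ∑ j ∈ Icc 1 k, ∑ X : (T.sys j).Dom, (if admB j X then (T.B j X (T.ofBackground U) a).re else 0)

/-- THE CONCRETE ACTION DATA at step `k`: the pre-cell record `Step.LFActionData` with `A(1/g_k²(·), ·) :=
smearedWilson (invSq T.flow φ k)` and `A(φ_j, ·) := smearedWilson (φ j)`; the summation ranges, the `S`-data `a` and the
constant `E_k` as given. [cite: Balaban1988Convergent, (2.23)–(2.25) pp.258–259] -/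
def concrete (T : LFTower P G Φ 𝒢 𝔄) (admE : (j : ℕ) → (T.sys j).Dom → T.Pt j → Bool)
    (admR admB : (j : ℕ) → (T.sys j).Dom → Bool) (φ : ℕ → Plaq P 0 → ℝ) (k : ℕ) (a : 𝔄) (Ek : ℝ) :
    LFActionData P G T where
  admE := admE
  admR := admR
  admB := admB
  wilsonLocal := smearedWilson (invSq T.flow φ k)
  wilsonPhi := fun j => smearedWilson (φ j)
  fluct := a
  Econst := Ek

/-- **(2.23) on the concrete data**: `A_k = −A(1/g_k²(·), U) + 𝐄_k(U) + 𝐑_k(U) + 𝐁_k(U, A) − E_k`, with `𝐄_k` = (2.25)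
WITH BODY. [cite: Balaban1988Convergent, (2.23) p.258, (2.25) p.259] -/
theorem action23_concrete (T : LFTower P G Φ 𝒢 𝔄) (admE : (j : ℕ) → (T.sys j).Dom → T.Pt j → Bool)
    (admR admB : (j : ℕ) → (T.sys j).Dom → Bool) (φ : ℕ → Plaq P 0 → ℝ) (k : ℕ) (a : 𝔄) (Ek : ℝ)
    (U : GaugeField P 0 G) :
    (concrete T admE admR admB φ k a Ek).action23 k U =
      - smearedWilson (invSq T.flow φ k) U + E225 T admE φ k U + R230 T admR k U + B240 T admB a k U - Ek := rfl

/-- The same with the bare Wilson term made explicit through the telescoping of §2: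
`A_k = −(1/g₀²)A(U) + Σ_{j=1}^{k} β_j(g_{j−1})A(φ_j, U) + 𝐄_k(U) + 𝐑_k(U) + 𝐁_k(U, A) − E_k` — i.e. the `−β_jA(φ_j, U)`
counterterms inside `𝐄_k` exactly compensate the passage from `1/g₀²` to `1/g_k²(·)`. [cite: Balaban1988Convergent, (2.23)–(2.25) pp.258–259] -/
theorem action23_concrete_bare (T : LFTower P G Φ 𝒢 𝔄) (admE : (j : ℕ) → (T.sys j).Dom → T.Pt j → Bool)
    (admR admB : (j : ℕ) → (T.sys j).Dom → Bool) (φ : ℕ → Plaq P 0 → ℝ) (k : ℕ) (a : 𝔄) (Ek : ℝ)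
    (U : GaugeField P 0 G) :
    (concrete T admE admR admB φ k a Ek).action23 k U =
      - (1 / (T.flow.g 0) ^ 2 * wilsonAction4 U) + ∑ j ∈ Icc 1 k, T.flow.β j (T.flow.g (j - 1)) * smearedWilson (φ j) U
        + E225 T admE φ k U + R230 T admR k U + B240 T admB a k U - Ek := by
  rw [action23_concrete, ← smearedWilson_invSq_zero T.flow φ U, smearedWilson_invSq_telescope T.flow φ U k]
  ring

/-- Consequently the `β_jA(φ_j, U)` terms cancel between the localized Wilson term and `𝐄_k`: `−A(1/g_k²(·), U) + 𝐄_k(U) =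
−(1/g₀²)A(U) + Σ_{j=1}^{k} [E^{(j)}(Λ_j, g_{j−1}, U) − E^{(j)}(Λ_j, g_{j−1}, 1)]`. [cite: Balaban1988Convergent, (2.23)–(2.25) pp.258–259] -/
theorem wilsonLocal_add_E225 (T : LFTower P G Φ 𝒢 𝔄) (admE : (j : ℕ) → (T.sys j).Dom → T.Pt j → Bool)
    (φ : ℕ → Plaq P 0 → ℝ) (k : ℕ) (U : GaugeField P 0 G) :
    - smearedWilson (invSq T.flow φ k) U + E225 T admE φ k U =
      - (1 / (T.flow.g 0) ^ 2 * wilsonAction4 U) + ∑ j ∈ Icc 1 k, EjSub T admE j U := by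
  rw [← smearedWilson_invSq_zero T.flow φ U, smearedWilson_invSq_telescope T.flow φ U k, E225, sum_sub_distrib]
  ring

end Literature.MathematicalPhysics.QuantumFieldTheory.Balaban1983to89.B14.Eq225Concrete

end
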